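import Literature.Barriers.CriticalPhenomena.WeaklySAWFlowContinuityCutoff
import Literature.Barriers.CriticalPhenomena.WeaklySAWFlowContinuity
import HarnessLib

/-!
# BBS 2015, §7.3 (item (b) of Step 2): flows obtained from [BBS-rg-flow, Theorem 1.4] with two values
# of `b` and two comparable weight systems coincide (uniqueness in the larger class)

File of the series formalising [BBS-rg-flow] (Bauerschmidt–Brydges–Slade, AHP 16 (2015),
arXiv:1211.2477) and its use in BBS 2015 (CMP 338) towards
`Literature.Barriers.CriticalPhenomena.WeaklySAWFourDimLogCorrections`; continuation of
`WeaklySAWFlowContinuity.lean` (`critFlow`: the flow of Theorem 1.4(i) with the natural weights `χ_j`)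
and `WeaklySAWFlowContinuityCutoff.lean` (`critFlowK`: the same at a frozen cut-off `k`, weights
`Ω^{-(j-k)₊}`).

BBS 2015, §7.3, observation (b) before Step 2: "The flexibility to choose any `b ∈ (0,1)` in Theorem
7.2.1 can be used to enhance the statement … we apply Theorem 7.2.1 with two choices of `b`, namely
`b₁ = ½` and `b₂ = ¼` … any solution that satisfies the bounds with `b = b₁` is unique … and hence must
be identical to the solution produced when `b = b₂`"; in Step 2 this identifies the solutions built with
the frozen data of a nearby point with the solution at the point itself ((Kmmgg): the frozen norms and
weights cost a factor absorbed by `b₂ < b₁`). Here, in the abstract framework: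
* `flowBounds_of_le_weights`: the bounds (1.11)–(1.14) at level `b` for weights `χ` imply the bounds at
  level `b'` for weights `χ'` whenever `χ_j ≤ Λχ'_j`, `Λb ≤ b'`, `b ≤ b'` (same base flow `x̄ = (K̄, V̄)`,
  which does not depend on the weights);
* **`critFlowK_eq_critFlow`**: at a point admissible for both, the critical flow built with a frozen
  cut-off `k` at level `b₂` (`critFlowK`) and the one built with the natural weights at level `b₁`
  (`critFlow`) COINCIDE, provided `Ω^{-(j-k)₊} ≤ Λχ_j` for all `j` with `Λb₂ ≤ b₁`, `b₂ ≤ b₁` — by the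
  uniqueness clause of Theorem 1.4(i) in the larger class.

## References
* R. Bauerschmidt, D. C. Brydges, G. Slade, CMP 338 (2015), arXiv:1403.7422: §7.3, observations
  (a)–(b) and Step 2 of the proof of Proposition 7.1.1 ((Kmmgg)). [BauerschmidtBrydgesSlade2015LogCorr]
* R. Bauerschmidt, D. C. Brydges, G. Slade, AHP 16 (2015), arXiv:1211.2477: Theorem 1.4(i)
  (uniqueness clause). [BauerschmidtBrydgesSlade2015Flow]
-/

noncomputable section

open Filter Topology Set

namespace Literature.Barriers.CriticalPhenomena

namespace CTWSAW

section Identification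

variable {Mext : Type*}
variable {W : ℕ → Type*} [∀ j, NormedAddCommGroup (W j)] [∀ j, NormedSpace ℝ (W j)] [∀ j, CompleteSpace (W j)]

omit [∀ j, NormedSpace ℝ (W j)] [∀ j, CompleteSpace (W j)] in
/-- **The bounds (1.11)–(1.14) are monotone in the weights and in `b`**: level `b` for weights `χ`
implies level `b'` for nonnegative weights `χ'` when `χ_j ≤ Λχ'_j`, `Λb ≤ b'` and `b ≤ b'` (the base flow
`x̄ = (K̄, V̄)` is the same). [cite: BauerschmidtBrydgesSlade2015LogCorr, §7.3 (observation (b) and (Kmmgg))] -/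
theorem flowBounds_of_le_weights {χ χ' : ℕ → ℝ} {ψ : ∀ j, W j × V3 → W (j + 1)} {Vb : ℕ → V3} {K₀ : W 0}
    {a aStar hh b b' Λ : ℝ} (haS : 0 ≤ a - aStar) (hh0 : 0 ≤ hh) (hg : ∀ j, 0 ≤ Vb j 0) (hb : 0 ≤ b)
    (hχ' : ∀ j, 0 ≤ χ' j) (hχ : ∀ j, χ j ≤ Λ * χ' j) (hΛ : Λ * b ≤ b') (hbb : b ≤ b')
    {x : ∀ j, W j × V3} (hx : FlowBounds χ ψ Vb K₀ a aStar hh b x) : FlowBounds χ' ψ Vb K₀ a aStar hh b' x := by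
  intro j
  obtain ⟨b1, b2, b3, b4⟩ := hx j
  have hg3 : 0 ≤ Vb j 0 ^ 3 := pow_nonneg (hg j) 3
  have hq : 0 ≤ Vb j 0 ^ 2 * |Real.log (Vb j 0)| := by positivity
  have hχb : b * χ j ≤ b' * χ' j := by
    calc b * χ j ≤ b * (Λ * χ' j) := mul_le_mul_of_nonneg_left (hχ j) hb
      _ = (Λ * b) * χ' j := by ring
      _ ≤ b' * χ' j := mul_le_mul_of_nonneg_right hΛ (hχ' j)
  refine ⟨?_, ?_, ?_, ?_⟩
  · calc ‖(x j).1 - Kbar ψ Vb K₀ j‖ ≤ b * (a - aStar) * χ j * Vb j 0 ^ 3 := b1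
      _ = (b * χ j) * ((a - aStar) * Vb j 0 ^ 3) := by ring
      _ ≤ (b' * χ' j) * ((a - aStar) * Vb j 0 ^ 3) := mul_le_mul_of_nonneg_right hχb (by positivity)
      _ = b' * (a - aStar) * χ' j * Vb j 0 ^ 3 := by ring
  · calc |(x j).2 0 - Vb j 0| ≤ b * hh * Vb j 0 ^ 2 * |Real.log (Vb j 0)| := b2
      _ = b * (hh * (Vb j 0 ^ 2 * |Real.log (Vb j 0)|)) := by ring
      _ ≤ b' * (hh * (Vb j 0 ^ 2 * |Real.log (Vb j 0)|)) := mul_le_mul_of_nonneg_right hbb (by positivity)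
      _ = b' * hh * Vb j 0 ^ 2 * |Real.log (Vb j 0)| := by ring
  · calc |(x j).2 1 - Vb j 1| ≤ b * hh * χ j * Vb j 0 ^ 2 * |Real.log (Vb j 0)| := b3
      _ = (b * χ j) * (hh * (Vb j 0 ^ 2 * |Real.log (Vb j 0)|)) := by ring
      _ ≤ (b' * χ' j) * (hh * (Vb j 0 ^ 2 * |Real.log (Vb j 0)|)) := mul_le_mul_of_nonneg_right hχb (by positivity)
      _ = b' * hh * χ' j * Vb j 0 ^ 2 * |Real.log (Vb j 0)| := by ring
  · calc |(x j).2 2 - Vb j 2| ≤ b * hh * χ j * Vb j 0 ^ 2 * |Real.log (Vb j 0)| := b4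
      _ = (b * χ j) * (hh * (Vb j 0 ^ 2 * |Real.log (Vb j 0)|)) := by ring
      _ ≤ (b' * χ' j) * (hh * (Vb j 0 ^ 2 * |Real.log (Vb j 0)|)) := mul_le_mul_of_nonneg_right hχb (by positivity)
      _ = b' * hh * χ' j * Vb j 0 ^ 2 * |Real.log (Vb j 0)| := by ring

variable (ψf : ∀ m : Mext, ∀ j, W j × V3 → W (j + 1)) (ρf : ∀ m : Mext, ∀ j, W j × V3 → V3)
variable {Pf : Mext → QuadFlowParams} {Ω B c lam C a κ R M aStar b₁ b₂ hh : ℝ} {k : ℕ∞}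

/-- **BBS 2015, §7.3, observation (b) / Step 2 (identification)**: at a point `q = (m, K₀, g₀)`
admissible both for the frozen cut-off `k` (level `b₂`, (A3) for the weights `Ω^{-(j-k)₊}`) and for the
natural weights `χ_j` (level `b₁`, (A3) for `χ`), if `Ω^{-(j-k)₊} ≤ Λχ_j` for all `j` with `Λb₂ ≤ b₁` and
`b₂ ≤ b₁`, then the two critical flows of Theorem 1.4(i) coincide: the frozen one obeys the natural
bounds at level `b₁` and the natural one is unique in that class.
[cite: BauerschmidtBrydgesSlade2015LogCorr, §7.3 (observation (b) and Step 2 of the proof of Proposition 7.1.1)] [cite: BauerschmidtBrydgesSlade2015Flow, Theorem 1.4(i) (uniqueness clause)] -/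
theorem critFlowK_eq_critFlow (hcK : ConstHyp Ω c lam C a κ R M aStar b₂ hh)
    (hAK : ∀ (m : Mext) (g : ℝ), 0 < g → g ≤ gThreshold Ω B c C lam M a aStar κ R b₂ hh →
      CutoffQuadHyp (Pf m) Ω k B c ⌊c⁻¹⌋₊ C lam g)
    (hc : ConstHyp Ω c lam C a κ R M aStar b₁ hh) (hA : ∀ m, HypA1 (Pf m).β Ω B c ∧ HypA2 (Pf m) Ω lam c C)
    {q : Mext × (W 0 × ℝ)} (hqK : AdmK Pf ψf ρf Ω B c lam C a κ R M aStar b₂ hh k q)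
    (hq : Adm Pf ψf ρf Ω B c lam C a κ R M aStar b₁ hh q)
    {Λ : ℝ} (hΛ : ∀ j, cutoffWeight Ω k j ≤ Λ * chi (Pf q.1).β Ω j) (hΛb : Λ * b₂ ≤ b₁) (hb : b₂ ≤ b₁) :
    critFlowK ψf ρf hcK hAK q = critFlow ψf ρf hc hA q := by
  obtain ⟨-, hflow, hK0, hg0, tz, tμ, hbd, -⟩ := critFlowK_spec ψf ρf hcK hAK hqK
  obtain ⟨-, -, -, -, -, -, -, huniq⟩ := critFlow_spec ψf ρf hc hA hq
  have hΩ := hc.one_lt_Ω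
  have hχ' : ∀ j, 0 ≤ chi (Pf q.1).β Ω j := fun j => (chi_pos_and_le_one (Pf q.1).β hΩ.le j).1.le
  have hgb : ∀ j, 0 ≤ (Pf q.1).flow q.2.2 j 0 := fun j => by
    rw [QuadFlowParams.flow_apply_zero]
    exact ((hAK q.1 q.2.2 hqK.1 hqK.2.1).gbar_pos j).le
  have hh0 : 0 ≤ hh := (one_le_hThreshold Ω c C lam M a aStar κ b₁).trans hc.hh_ge |> fun h1 => by linarith
  have hbd' := flowBounds_of_le_weights (by linarith [hc.aStar_lt]) hh0 hgb hcK.b_pos.le hχ' hΛ hΛb hb hbd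
  exact huniq _ hflow hK0 hg0 tz tμ hbd'

end Identification

end CTWSAW

end Literature.Barriers.CriticalPhenomena
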